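import Mathlib
import HarnessLib
import Summits.KontsevichZagierPeriods.Statement
import Summits.KontsevichZagierPeriods.KontsevichZagierPeriods.Theses.RootDecompRelativeModAbsolute
import Literature.NumberTheory.Transcendental.KZCalculus
import Literature.NumberTheory.Transcendental.KZLogCalculusProofs

/-!
# Negative knowledge for item `LogFoldingDegOne` (stmt-KontsevichZagierPeriods-29577), part 1: the witness

Route `RootDecompRelativeModAbsolute` (sub-problem `KontsevichZagierPeriods`).  The rank-9 support item
`LogFoldingDegOne` («every KZ-rational 2-dimensional representation with `deg_t q ≤ 1` is KZ-equivalent to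
the fold of an ADMISSIBLE log term with the same fibre integrals a.e.») is FALSE.  This file carries the
witness `r₀ = [(0,1)², t/(1+x t)]` (`cex`, honest, `IsRationalDegLE 1`), its fibre function
`F(x) = 1/x − log(1+x)/x²` (`fibreIntegral_cex`), a regularity lemma for admissible log terms and the
non-integrability of `x⁻¹` on `(0,1)`.  Part 2 (`FalseOfLogLinearDescent.lean`) proves
`LogLinearDescent → ¬ LogFoldingDegOne`; the unconditional refutation composes it with the tree theorem.

Provenance: workshop `decomp-kz`, lens 3 generation 8 (file `RelativeModAbsoluteDegOneObstruction.lean`,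
sha256 92deee75…), re-namespaced and split for landing by the critic seat; mathematics unchanged.
-/

noncomputable section

open Set MeasureTheory Filter Topology
open scoped BigOperators
open Literature.NumberTheory.Transcendental Literature.ModelTheory.ExponentialFields
open Summit.KontsevichZagierPeriods.KontsevichZagierPeriods.Theses.RootDecompRelativeModAbsolute

namespace Summit.KontsevichZagierPeriods.RootDecompRelativeModAbsolute
namespace LogFoldingDegOneNegative

/-! ## §1 The witness `r₀ = [(0,1)², t/(1+xt)]` -/

/-- The open unit square `(0,1)²` in `ℝ^{1+1}` (coordinates `z 0 = x`, `z (Fin.last 1) = t`). -/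
def sq : Set (Fin (1 + 1) → ℝ) := {z | z 0 ∈ Ioo (0 : ℝ) 1 ∧ z (Fin.last 1) ∈ Ioo (0 : ℝ) 1}

/-- The integrand `t / (1 + x t)`. -/
def cexFun (z : Fin (1 + 1) → ℝ) : ℝ := z (Fin.last 1) / (1 + z 0 * z (Fin.last 1))

/-- The open unit square `sq` is open. -/
theorem isOpen_sq : IsOpen sq :=
  (isOpen_Ioo.preimage (continuous_apply 0)).inter
    (isOpen_Ioo.preimage (continuous_apply (Fin.last 1)))

/-- The open unit square `sq` is `ℚ`-semialgebraic. -/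
theorem isSemialgebraic_sq : IsSemialgebraic ℚ sq := by
  have h1 := isSemialgebraic_setOf_eval_pos (k := ℚ) (R := ℝ) (MvPolynomial.X (0 : Fin (1 + 1)))
  have h2 := isSemialgebraic_setOf_eval_lt (k := ℚ) (R := ℝ) (MvPolynomial.X (0 : Fin (1 + 1))) 1
  have h3 := isSemialgebraic_setOf_eval_pos (k := ℚ) (R := ℝ) (MvPolynomial.X (Fin.last 1 : Fin (1 + 1)))
  have h4 := isSemialgebraic_setOf_eval_lt (k := ℚ) (R := ℝ)
    (MvPolynomial.X (Fin.last 1 : Fin (1 + 1))) 1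
  convert (h1.inter h2).inter (h3.inter h4) using 1
  ext z
  simp only [sq, mem_Ioo, mem_setOf_eq, mem_inter_iff, MvPolynomial.aeval_X, map_one]

/-- On `sq` the denominator `1 + x t` is positive. -/
theorem one_add_mul_pos {z : Fin (1 + 1) → ℝ} (hz : z ∈ sq) : 0 < 1 + z 0 * z (Fin.last 1) := by
  have := mul_pos hz.1.1 hz.2.1
  linarith

/-- The witness integrand `t/(1+xt)` is continuous on `sq`. -/
theorem continuousOn_cexFun : ContinuousOn cexFun sq := by
  refine ((continuous_apply (Fin.last 1)).continuousOn).div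
    (continuous_const.add ((continuous_apply 0).mul (continuous_apply (Fin.last 1)))).continuousOn
    fun z hz => (one_add_mul_pos hz).ne'

/-- The witness integrand is nonnegative on `sq`. -/
theorem cexFun_nonneg {z : Fin (1 + 1) → ℝ} (hz : z ∈ sq) : 0 ≤ cexFun z :=
  div_nonneg hz.2.1.le (one_add_mul_pos hz).le

/-- The witness integrand is at most `1` on `sq`. -/
theorem cexFun_le_one {z : Fin (1 + 1) → ℝ} (hz : z ∈ sq) : cexFun z ≤ 1 := by
  rw [cexFun, div_le_one (one_add_mul_pos hz)]
  have := mul_pos hz.1.1 hz.2.1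
  linarith [hz.2.2]

/-- The open unit square `sq` is bounded. -/
theorem isBounded_sq : Bornology.IsBounded sq := by
  rw [isBounded_iff_forall_norm_le]
  refine ⟨1, fun z hz => ?_⟩
  rw [pi_norm_le_iff_of_nonneg zero_le_one]
  intro i
  rw [Real.norm_eq_abs, abs_le]
  rcases Fin.eq_zero_or_eq_succ i with rfl | ⟨j, rfl⟩
  · exact ⟨by linarith [hz.1.1], hz.1.2.le⟩
  · have hj : j = 0 := Subsingleton.elim _ _
    subst hj
    have : (Fin.succ (0 : Fin 1) : Fin (1 + 1)) = Fin.last 1 := rfl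
    rw [this]
    exact ⟨by linarith [hz.2.1], hz.2.2.le⟩

/-- **The witness** `r₀ = [(0,1)², t/(1+xt)]`: an honest KZ integral representation. -/
def cex : KZ.IntegralRep (1 + 1) where
  domain := sq
  integrand := cexFun
  isSemialgebraic_domain := isSemialgebraic_sq
  isSemialgebraicFunOn_integrand := by
    have h := isSemialgebraicFunOn_aeval_div_aeval (k := ℚ) isSemialgebraic_sq
      (MvPolynomial.X (Fin.last 1)) (1 + MvPolynomial.X 0 * MvPolynomial.X (Fin.last 1))
      (fun z hz => by
        simpa only [map_add, map_one, map_mul, MvPolynomial.aeval_X] using (one_add_mul_pos hz).ne')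
    refine h.congr fun z _ => ?_
    simp only [cexFun, map_add, map_one, map_mul, MvPolynomial.aeval_X]
  integrableOn := by
    refine ⟨continuousOn_cexFun.aestronglyMeasurable isOpen_sq.measurableSet, ?_⟩
    refine HasFiniteIntegral.restrict_of_bounded (C := (1 : ℝ)) isBounded_sq.measure_lt_top ?_
    refine (ae_restrict_iff' isOpen_sq.measurableSet).2 (Eventually.of_forall fun z hz => ?_)
    rw [Real.norm_eq_abs, abs_le]
    exact ⟨by linarith [cexFun_nonneg hz], cexFun_le_one hz⟩

/-- The domain of the witness `cex` is `sq` (by definition). -/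
@[simp] theorem cex_domain : cex.domain = sq := rfl
/-- The integrand of the witness `cex` is `cexFun` (by definition). -/
@[simp] theorem cex_integrand : cex.integrand = cexFun := rfl

/-- `r₀` has KZ-rational shape with `deg_t q ≤ 1` (`p = X_t`, `q = 1 + X_x X_t`), literally as in the
item `LogFoldingDegOne`. -/
theorem cex_isRationalDegLE :
    ∃ p q : MvPolynomial (Fin (1 + 1)) ℚ, MvPolynomial.degreeOf (Fin.last 1) q ≤ 1 ∧
      (∀ z ∈ cex.domain, MvPolynomial.aeval z q ≠ 0) ∧
      Set.EqOn cex.integrand (fun z => MvPolynomial.aeval z p / MvPolynomial.aeval z q) cex.domain := by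
  classical
  refine ⟨MvPolynomial.X (Fin.last 1), 1 + MvPolynomial.X 0 * MvPolynomial.X (Fin.last 1), ?_, ?_, ?_⟩
  · refine (MvPolynomial.degreeOf_add_le _ _ _).trans (max_le ?_ ?_)
    · rw [show (1 : MvPolynomial (Fin (1 + 1)) ℚ) = MvPolynomial.C 1 from MvPolynomial.C_1.symm,
        MvPolynomial.degreeOf_C]
      exact Nat.zero_le _
    · refine (MvPolynomial.degreeOf_mul_le _ _ _).trans ?_
      rw [MvPolynomial.degreeOf_X, MvPolynomial.degreeOf_X]
      simp
  · intro z hz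
    simpa only [map_add, map_one, map_mul, MvPolynomial.aeval_X] using (one_add_mul_pos hz).ne'
  · intro z _
    simp only [cex_integrand, cexFun, map_add, map_one, map_mul, MvPolynomial.aeval_X]

/-! ## §2 The fibre function `F(x) = 1/x − log(1+x)/x²` -/

/-- `F(x) = x⁻¹ − x⁻¹ ^ 2 · log (1 + x)`. -/
def F (a : ℝ) : ℝ := a⁻¹ - (a⁻¹) ^ 2 * Real.log (1 + a)

/-- `F` is positive on `(0,1)` (since `log (1+x) < x` there). -/
theorem F_pos {a : ℝ} (ha : a ∈ Ioo (0 : ℝ) 1) : 0 < F a := by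
  have ha0 : 0 < a := ha.1
  have hlog : Real.log (1 + a) < a := by
    rw [Real.log_lt_iff_lt_exp (by linarith)]
    linarith [Real.add_one_lt_exp ha0.ne']
  have h1 : (a⁻¹) ^ 2 * Real.log (1 + a) < (a⁻¹) ^ 2 * a :=
    mul_lt_mul_of_pos_left hlog (by positivity)
  have h2 : (a⁻¹) ^ 2 * a = a⁻¹ := by field_simp
  rw [h2] at h1
  simp only [F]
  linarith

/-- `F` is continuous on `(0,1)`. -/
theorem continuousOn_F : ContinuousOn F (Ioo (0 : ℝ) 1) := by
  refine ContinuousOn.sub (continuousOn_inv₀.mono fun a ha => ha.1.ne') ?_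
  refine ((continuousOn_inv₀.mono fun a ha => ?_).pow 2).mul
    ((continuous_const.add continuous_id).continuousOn.log fun a ha => ?_)
  · exact ha.1.ne'
  · exact (show (0 : ℝ) < 1 + a by linarith [ha.1]).ne'

/-- The one-variable integral: `∫₀¹ t/(1 + a t) dt = F a` for `0 < a`. -/
theorem integral_cexFun_fibre {a : ℝ} (ha : 0 < a) :
    ∫ t in Ioo (0 : ℝ) 1, t / (1 + a * t) = F a := by
  rw [← integral_Ioc_eq_integral_Ioo, ← intervalIntegral.integral_of_le zero_le_one]
  have hden : ∀ t ∈ uIcc (0 : ℝ) 1, 0 < 1 + a * t := by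
    intro t ht
    rw [uIcc_of_le zero_le_one] at ht
    have := mul_nonneg ha.le ht.1
    linarith
  have hderiv : ∀ t ∈ uIcc (0 : ℝ) 1,
      HasDerivAt (fun t => t * a⁻¹ - (a⁻¹) ^ 2 * Real.log (1 + a * t)) (t / (1 + a * t)) t := by
    intro t ht
    have h0 := hden t ht
    have h1 : HasDerivAt (fun t => 1 + a * t) a t := by
      simpa using ((hasDerivAt_id t).const_mul a).const_add 1
    have h2 : HasDerivAt (fun t => Real.log (1 + a * t)) (a / (1 + a * t)) t := h1.log h0.ne'
    have h3 : HasDerivAt (fun y => y * a⁻¹ - (a⁻¹) ^ 2 * Real.log (1 + a * y))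
        (1 * a⁻¹ - (a⁻¹) ^ 2 * (a / (1 + a * t))) t :=
      ((hasDerivAt_id t).mul_const a⁻¹).sub (h2.const_mul ((a⁻¹) ^ 2))
    refine h3.congr_deriv ?_
    have h0' : 1 + a * t ≠ 0 := h0.ne'
    have ha' : a ≠ 0 := ha.ne'
    field_simp
    ring
  have hint : IntervalIntegrable (fun t => t / (1 + a * t)) volume 0 1 := by
    refine ContinuousOn.intervalIntegrable ?_
    exact continuousOn_id.div (continuousOn_const.add (continuousOn_const.mul continuousOn_id))
      fun t ht => (hden t ht).ne'
  rw [intervalIntegral.integral_eq_sub_of_hasDerivAt hderiv hint]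
  simp [F]

/-- The base box `(0,1) ⊆ ℝ¹`. -/
def box : Set (Fin 1 → ℝ) := {x | x 0 ∈ Ioo (0 : ℝ) 1}

/-- The base box `(0,1) ⊆ ℝ¹` is open. -/
theorem isOpen_box : IsOpen box := isOpen_Ioo.preimage (continuous_apply 0)

/-- The base box `(0,1) ⊆ ℝ¹` is `ℚ`-semialgebraic. -/
theorem isSemialgebraic_box : IsSemialgebraic ℚ box := by
  have h1 := isSemialgebraic_setOf_eval_pos (k := ℚ) (R := ℝ) (MvPolynomial.X (0 : Fin 1))
  have h2 := isSemialgebraic_setOf_eval_lt (k := ℚ) (R := ℝ) (MvPolynomial.X (0 : Fin 1)) 1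
  convert h1.inter h2 using 1
  ext x
  simp only [box, mem_Ioo, mem_setOf_eq, mem_inter_iff, MvPolynomial.aeval_X, map_one]

/-- For `x` in the base box, the fibre of `sq` over `x` is `(0,1)`. -/
theorem fibre_sq_of_mem {x : Fin 1 → ℝ} (hx : x ∈ box) :
    {t : ℝ | (Fin.snoc x t : Fin (1 + 1) → ℝ) ∈ sq} = Ioo (0 : ℝ) 1 := by
  ext t
  have e0 : (Fin.snoc x t : Fin (1 + 1) → ℝ) 0 = x 0 := rfl
  simp only [sq, mem_setOf_eq, e0, Fin.snoc_last, mem_Ioo]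
  exact ⟨fun h => h.2, fun h => ⟨hx, h⟩⟩

/-- For `x` outside the base box, the fibre of `sq` over `x` is empty. -/
theorem fibre_sq_of_not_mem {x : Fin 1 → ℝ} (hx : x ∉ box) :
    {t : ℝ | (Fin.snoc x t : Fin (1 + 1) → ℝ) ∈ sq} = ∅ := by
  ext t
  have e0 : (Fin.snoc x t : Fin (1 + 1) → ℝ) 0 = x 0 := rfl
  simp only [sq, mem_setOf_eq, e0, Fin.snoc_last, mem_empty_iff_false, iff_false, not_and]
  exact fun h _ => (hx h).elim

/-- **Fibre function of the witness**: `∫_{t : (x,t) ∈ (0,1)²} t/(1+xt) dt = 1_{(0,1)}(x) · F(x)`. -/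
theorem fibreIntegral_cex (x : Fin 1 → ℝ) :
    (∫ t in {t : ℝ | (Fin.snoc x t : Fin (1 + 1) → ℝ) ∈ cex.domain}, cex.integrand (Fin.snoc x t)) =
      box.indicator (fun x => F (x 0)) x := by
  rw [cex_domain]
  by_cases hx : x ∈ box
  · rw [fibre_sq_of_mem hx, indicator_of_mem hx]
    have e0 : ∀ t : ℝ, (Fin.snoc x t : Fin (1 + 1) → ℝ) 0 = x 0 := fun _ => rfl
    simp only [cex_integrand, cexFun, Fin.snoc_last, e0]
    exact integral_cexFun_fibre hx.1
  · rw [fibre_sq_of_not_mem hx, indicator_of_notMem hx, Measure.restrict_empty,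
      integral_zero_measure]


/-! ## §3 The refutation -/

/-- **Regularity** (variant of the g7 lemma `exists_isOpen_continuousOn`): the data `h₀, hᵢ, vᵢ` of an
admissible log term are continuous on an open `ℚ`-semialgebraic `G ⊆ σ` with `σ ∖ G` null
(`KZ.exists_isOpen_contDiffOn`). [folklore] -/
theorem exists_isOpen_continuousOn_data {n : ℕ} (T : KZlog.IntegralRep n) :
    ∃ G : Set (Fin n → ℝ), G ⊆ T.domain ∧ IsOpen G ∧ IsSemialgebraic ℚ G ∧
      volume (T.domain \ G) = 0 ∧ ContinuousOn T.h₀ G ∧ (∀ i, ContinuousOn (T.h i) G) ∧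
      (∀ i, ContinuousOn (T.v i) G) := by
  have hσ := T.admissible.isSemialgebraic_domain
  obtain ⟨G₀, hG₀σ, hG₀o, hG₀s, hG₀c, -, hG₀n⟩ :=
    KZ.exists_isOpen_contDiffOn hσ T.admissible.isSemialgebraicFunOn_h₀
  choose Gh hGhσ hGho hGhs hGhc _x hGhn using
    fun i => KZ.exists_isOpen_contDiffOn hσ (T.admissible.isSemialgebraicFunOn_h i)
  choose Gv hGvσ hGvo hGvs hGvc _y hGvn using
    fun i => KZ.exists_isOpen_contDiffOn hσ (T.admissible.isSemialgebraicFunOn_v i)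
  let G : Set (Fin n → ℝ) := G₀ ∩ ⋂ i ∈ (Finset.univ : Finset (Fin T.k)), (Gh i ∩ Gv i)
  have hGσ : G ⊆ T.domain := fun x hx => hG₀σ hx.1
  have hGi : ∀ i, G ⊆ Gh i ∩ Gv i := fun i x hx =>
    (mem_iInter₂.1 hx.2) i (Finset.mem_univ i)
  refine ⟨G, hGσ, hG₀o.inter (isOpen_biInter_finset fun i _ => (hGho i).inter (hGvo i)),
    hG₀s.inter (IsSemialgebraic.biInter _ _ fun i _ => (hGhs i).inter (hGvs i)), ?_,
    hG₀c.continuousOn.mono fun x hx => hx.1,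
    fun i => (hGhc i).continuousOn.mono fun x hx => (hGi i hx).1,
    fun i => (hGvc i).continuousOn.mono fun x hx => (hGi i hx).2⟩
  have hsub : T.domain \ G ⊆ (T.domain \ G₀) ∪ ⋃ i, ((T.domain \ Gh i) ∪ (T.domain \ Gv i)) := by
    intro x hx
    by_cases h0 : x ∈ G₀
    · have : x ∉ ⋂ i ∈ (Finset.univ : Finset (Fin T.k)), (Gh i ∩ Gv i) := fun h => hx.2 ⟨h0, h⟩
      simp only [mem_iInter, not_forall] at this
      obtain ⟨i, -, hi⟩ := this
      refine Or.inr (mem_iUnion.2 ⟨i, ?_⟩)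
      by_cases h1 : x ∈ Gh i
      · exact Or.inr ⟨hx.1, fun h2 => hi ⟨h1, h2⟩⟩
      · exact Or.inl ⟨hx.1, h1⟩
    · exact Or.inl ⟨hx.1, h0⟩
  exact measure_mono_null hsub (measure_union_null hG₀n
    (measure_iUnion_null fun i => measure_union_null (hGhn i) (hGvn i)))

/-- **`x ↦ x⁻¹` is not integrable on `(0,1)`** (Mathlib `intervalIntegrable_inv_iff`). -/
theorem not_integrableOn_inv_Ioo : ¬ IntegrableOn (fun t : ℝ => t⁻¹) (Ioo (0 : ℝ) 1) := by
  intro h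
  have h' : IntervalIntegrable (fun t : ℝ => t⁻¹) volume 0 1 :=
    (intervalIntegrable_iff_integrableOn_Ioo_of_le zero_le_one).2 h
  rw [intervalIntegrable_inv_iff] at h'
  rcases h' with h' | h'
  · exact zero_ne_one h'
  · exact h' (by simp)

/-- Transfer `ℝ¹ → ℝ`: integrability of `x ↦ (x 0)⁻¹` on the box `(0,1) ⊆ ℝ¹` fails. -/
theorem not_integrableOn_inv_box : ¬ IntegrableOn (fun x : Fin 1 → ℝ => (x 0)⁻¹) box := by
  intro h
  apply not_integrableOn_inv_Ioo
  have hmp := volume_preserving_funUnique (Fin 1) ℝ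
  rw [← hmp.integrableOn_comp_preimage (MeasurableEquiv.funUnique (Fin 1) ℝ).measurableEmbedding]
  have e1 : ((fun t : ℝ => t⁻¹) ∘ ⇑(MeasurableEquiv.funUnique (Fin 1) ℝ)) =
      fun x : Fin 1 → ℝ => (x 0)⁻¹ := by
    funext x
    simp only [Function.comp_apply, MeasurableEquiv.funUnique_apply, Fin.default_eq_zero]
  have e2 : ⇑(MeasurableEquiv.funUnique (Fin 1) ℝ) ⁻¹' Ioo (0 : ℝ) 1 = box := by
    ext x
    simp only [mem_preimage, MeasurableEquiv.funUnique_apply, Fin.default_eq_zero, box, mem_setOf_eq]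
  rw [e1, e2]
  exact h

end LogFoldingDegOneNegative

end Summit.KontsevichZagierPeriods.RootDecompRelativeModAbsolute

end
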